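import Summits.QuantumFields.GaugeBoot.CutLoopCharacterPositivity
import Summits.QuantumFields.GaugeBoot.HaarAverageProjection
import HarnessLib

/-!
# Reflection positivity bounds every character of a mirror-cut loop below by the number of
invariants: `⟨Re tr τ(U_p)⟩ ≥ m₀(τ) = ∫ Re χ_τ dk` (gauge-boot, Class B; all-representations form 1/3)

HONEST FRAMING (cell `pub-gaugeboot`, page 1 of every file): the venture produces certified bounds
on lattice expectations at stated coupling, gauge group, dimension and torus size; NOT a mass gap,
NOT a continuum limit, NOT a string tension; NOT Yang–Mills-summit-bearing (barriers
`FixedCouplingUltralocality`, `PerturbativeInvisibility`). Structural statement about the states a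
loop-equation certificate with diagonal (`R_diag`) blocks speaks about (Class B, SCOPING A18); it
certifies no number.

## Content

`CutLoopCharacterPositivity.lean` proved `0 ≤ ∫ Re tr τ(U_p) dμ` for every continuous representation
`τ` under a diagonal reflection positivity. Here the bound is sharpened from `0` to the Haar mean of
the character, `m₀(τ) = ∫ Re tr τ(k) dk = Re tr P` with `P = ∫ σ(k) dk` the projection onto the
`σ`-invariant vectors (`HaarAverageProjection.lean`) — the multiplicity of the trivial representation
in `τ`; the old bound is the case `m₀ = 0`.

* ★★ **`integral_re_trace_mul_inv_sub_nonneg_of_rp`** (the mechanism; any configuration space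
  `ι → G`, any finite measure, any `Θ` with `C ∘ Θ = D`): RP pairings of the entries of `Qσ(C)`,
  `Q = 1 - P`, give `0 ≤ ∫ (Re tr τ(C U (D U)⁻¹) - m₀(τ)) dμ`; `le_integral_re_trace_mul_inv_of_rp`
  (probability measures: `m₀(τ) ≤ ∫ Re tr τ(C D⁻¹) dμ`).
* ★★ **`wilsonExpectation_re_trace_rep_plaquette_ge_of_diagonalReflectionPositive`** (torus
  `(ℤ/L)^d`, `L ≥ 2`), ★★ **`integral_re_trace_plaquette_sub_nonneg_of_isReflectionPositiveFor_diag`**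
  / `…_ge_…` (`ℤ^d`), ★★ **`ClassBState.integral_re_trace_plaquette_ge`** /
  `ClassBState.integral_plaquetteObs_ge`: under closed-half diagonal RP, `m₀(τ) ≤ ⟨Re tr τ(U_p)⟩`
  for EVERY continuous representation `τ`, every plaquette (e.g. `τ = ρ ⊗ ρ̄`: `⟨|tr ρ(U_p)|²⟩ ≥ 1`).

Parts 2/3 (`HaarShiftPlaquetteSignAllReps.lean`, `ClassBNegativeCouplingAllReps.lean`) combine this
with the one-link Haar-shift identity to classify Class B at `β < 0` for EVERY representation of
the action: inhabited iff the representation is trivial. RP ⇒ positive type is Osterwalder–Seiler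
1978 §2; the diagonal/torus/Class-B statements are not in print as far as the cell's searches go.
-/

open MeasureTheory Complex Finset Function
open scoped ComplexOrder Matrix

namespace Summit.QuantumFields.GaugeBoot

open Literature.MathematicalPhysics.QuantumFieldTheory
open Literature.MathematicalPhysics.QuantumLattice
open Literature.RepresentationTheory.CompactGroups

noncomputable section

/-! ## The mechanism -/

section Mechanism

variable {ι : Type*} {M : ℕ} {G : Type*} [Group G] [TopologicalSpace G] [IsTopologicalGroup G]
  [CompactSpace G] [MeasurableSpace G] [BorelSpace G] (τ : G →* Matrix (Fin M) (Fin M) ℂ)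

omit [MeasurableSpace G] [BorelSpace G] in
/-- Entries of `Q σ(x)` are bounded uniformly in `x`: `‖(Qσ(x))_{ab}‖ ≤ ∑_c ‖Q_{ac}‖`. -/
theorem norm_proj_unitarize_entry_le (hτ : Continuous τ) (Q : Matrix (Fin M) (Fin M) ℂ) (x : G)
    (a b : Fin M) :
    ‖(Q * CompactGroup.unitarize τ hτ x) a b‖ ≤ ∑ c, ‖Q a c‖ := by
  rw [Matrix.mul_apply]
  refine (norm_sum_le _ _).trans (Finset.sum_le_sum fun c _ => ?_)
  rw [norm_mul]
  calc ‖Q a c‖ * ‖CompactGroup.unitarize τ hτ x c b‖ ≤ ‖Q a c‖ * 1 :=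
        mul_le_mul_of_nonneg_left (CompactGroup.norm_unitarize_apply_le_one τ hτ x c b) (norm_nonneg _)
    _ = ‖Q a c‖ := mul_one _

omit [BorelSpace G] in
/-- Entries of `Q σ(C U)` are measurable in `U` when those of `σ(C U)` are. -/
theorem measurable_proj_unitarize_entry {ι : Type*} (hτ : Continuous τ) (Q : Matrix (Fin M) (Fin M) ℂ)
    {C : (ι → G) → G} (hC : WilsonRP.EntryMeasurable (CompactGroup.unitarize τ hτ) C) (a b : Fin M) :
    Measurable fun U => (Q * CompactGroup.unitarize τ hτ (C U)) a b := by
  simp only [Matrix.mul_apply]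
  exact Finset.measurable_sum _ fun c _ => (hC c b).const_mul _


/-- ★★ **RP pairings of the projected entries of a half path bound the character of the closed loop
below by the number of invariants.** `τ` continuous, `σ = unitarize τ`, `P = ∫ σ dk`, `Q = 1 - P`;
`μ` a finite measure on `ι → G`; `C, D : (ι → G) → G` entrywise measurable with `C ∘ Θ = D`. If
`0 ≤ ∫ ((Qσ(C(ΘU)))_{ab})‾ (Qσ(C U))_{ab} dμ` for all `a, b` (what ANY reflection positivity of `μ`
w.r.t. `Θ` gives when `C` is a half observable), then `0 ≤ ∫ (Re tr τ(C U (D U)⁻¹) - m₀(τ)) dμ`,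
`m₀(τ) = ∫ Re tr τ dk = Re tr P`. -/
theorem integral_re_trace_mul_inv_sub_nonneg_of_rp (hτ : Continuous τ) {μ : Measure (ι → G)}
    [IsFiniteMeasure μ] {Θ : (ι → G) → (ι → G)} {C D : (ι → G) → G}
    (hC : WilsonRP.EntryMeasurable (CompactGroup.unitarize τ hτ) C)
    (hD : WilsonRP.EntryMeasurable (CompactGroup.unitarize τ hτ) D) (hΘ : ∀ U, C (Θ U) = D U)
    (hRP : ∀ a b, 0 ≤ ∫ U, (starRingEnd ℂ)
      (((1 - TwistedSlab.haarAvg τ hτ) * CompactGroup.unitarize τ hτ (C (Θ U))) a b) *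
      ((1 - TwistedSlab.haarAvg τ hτ) * CompactGroup.unitarize τ hτ (C U)) a b ∂μ) :
    0 ≤ ∫ U, (((τ (C U * (D U)⁻¹)).trace).re - ((TwistedSlab.haarAvg τ hτ).trace).re) ∂μ := by
  set σ := CompactGroup.unitarize τ hτ with hσ
  set Q : Matrix (Fin M) (Fin M) ℂ := 1 - TwistedSlab.haarAvg τ hτ with hQ
  set K : Fin M → ℝ := fun a => ∑ c, ‖Q a c‖ with hK
  -- the real integrands `g_{ab}` and their sum
  set g : Fin M → Fin M → (ι → G) → ℝ :=
    fun a b U => ((Q * σ (C U)) a b * (starRingEnd ℂ) ((Q * σ (D U)) a b)).re with hg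
  have hsum : ∀ U : ι → G, ((τ (C U * (D U)⁻¹)).trace).re - ((TwistedSlab.haarAvg τ hτ).trace).re =
      ∑ a, ∑ b, g a b U := fun U => re_trace_mul_inv_sub_eq_sum τ hτ (C U) (D U)
  have hfm : ∀ a b, Measurable fun U => (Q * σ (C U)) a b * (starRingEnd ℂ) ((Q * σ (D U)) a b) :=
    fun a b => (measurable_proj_unitarize_entry τ hτ Q hC a b).mul
      (Complex.continuous_conj.measurable.comp (measurable_proj_unitarize_entry τ hτ Q hD a b))
  have hfb : ∀ a b U, ‖(Q * σ (C U)) a b * (starRingEnd ℂ) ((Q * σ (D U)) a b)‖ ≤ K a * K a :=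
    fun a b U => by
    rw [norm_mul, Complex.norm_conj]
    exact mul_le_mul (norm_proj_unitarize_entry_le τ hτ Q _ a b)
      (norm_proj_unitarize_entry_le τ hτ Q _ a b) (norm_nonneg _)
      (Finset.sum_nonneg fun c _ => norm_nonneg _)
  have hfi : ∀ a b, Integrable (fun U => (Q * σ (C U)) a b * (starRingEnd ℂ) ((Q * σ (D U)) a b)) μ :=
    fun a b => Integrable.of_bound (hfm a b).aestronglyMeasurable (K a * K a) (ae_of_all _ (hfb a b))
  have hgi : ∀ a b, Integrable (g a b) μ := fun a b => (hfi a b).re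
  have hterm : ∀ a b, 0 ≤ ∫ U, g a b U ∂μ := by
    intro a b
    have h := hRP a b
    have hint : (fun U => (starRingEnd ℂ) ((Q * σ (C (Θ U))) a b) * (Q * σ (C U)) a b) =
        fun U => (Q * σ (C U)) a b * (starRingEnd ℂ) ((Q * σ (D U)) a b) := by
      funext U
      rw [hΘ U, mul_comm]
    rw [hint] at h
    have hre := integral_re (hfi a b)
    simp only [RCLike.re_to_complex] at hre
    change 0 ≤ ∫ U, ((Q * σ (C U)) a b * (starRingEnd ℂ) ((Q * σ (D U)) a b)).re ∂μ
    rw [hre]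
    exact (Complex.nonneg_iff.1 h).1
  calc (0 : ℝ) ≤ ∑ a, ∑ b, ∫ U, g a b U ∂μ :=
        Finset.sum_nonneg fun a _ => Finset.sum_nonneg fun b _ => hterm a b
    _ = ∫ U, ∑ a, ∑ b, g a b U ∂μ := by
        rw [integral_finsetSum Finset.univ
          (fun a _ => integrable_finsetSum Finset.univ fun b _ => hgi a b)]
        exact Finset.sum_congr rfl fun a _ =>
          (integral_finsetSum Finset.univ fun b _ => hgi a b).symm
    _ = ∫ U, (((τ (C U * (D U)⁻¹)).trace).re - ((TwistedSlab.haarAvg τ hτ).trace).re) ∂μ :=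
        integral_congr_ae (ae_of_all _ fun U => (hsum U).symm)

omit [BorelSpace G] in
/-- The loop character `U ↦ Re tr τ(C U (D U)⁻¹)` is integrable for every finite measure as soon as
the entries of `σ(C U)`, `σ(D U)` are measurable (it is the bounded Gram sum
`∑_{ab} Re (σ(C)_{ab} conj σ(D)_{ab})`, tree `CompactGroup.re_trace_mul_inv_eq_sum`). -/
theorem integrable_re_trace_mul_inv (hτ : Continuous τ) {μ : Measure (ι → G)} [IsFiniteMeasure μ]
    {C D : (ι → G) → G} (hC : WilsonRP.EntryMeasurable (CompactGroup.unitarize τ hτ) C)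
    (hD : WilsonRP.EntryMeasurable (CompactGroup.unitarize τ hτ) D) :
    Integrable (fun U => ((τ (C U * (D U)⁻¹)).trace).re) μ := by
  set σ := CompactGroup.unitarize τ hτ with hσ
  have h : (fun U => ((τ (C U * (D U)⁻¹)).trace).re) =
      fun U => ∑ a, ∑ b, (σ (C U) a b * (starRingEnd ℂ) (σ (D U) a b)).re :=
    funext fun U => CompactGroup.re_trace_mul_inv_eq_sum τ hτ (C U) (D U)
  rw [h]
  refine integrable_finsetSum _ fun a _ => integrable_finsetSum _ fun b _ => ?_
  have hfm : Measurable fun U => σ (C U) a b * (starRingEnd ℂ) (σ (D U) a b) :=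
    (hC a b).mul (Complex.continuous_conj.measurable.comp (hD a b))
  have hfb : ∀ U, ‖σ (C U) a b * (starRingEnd ℂ) (σ (D U) a b)‖ ≤ 1 := fun U => by
    rw [norm_mul, Complex.norm_conj]
    calc ‖σ (C U) a b‖ * ‖σ (D U) a b‖ ≤ 1 * 1 :=
          mul_le_mul (CompactGroup.norm_unitarize_apply_le_one τ hτ _ a b)
            (CompactGroup.norm_unitarize_apply_le_one τ hτ _ a b) (norm_nonneg _) zero_le_one
      _ = 1 := one_mul 1
  exact (Integrable.of_bound hfm.aestronglyMeasurable 1 (ae_of_all _ hfb)).re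

/-- ★★ The probability-measure form of the mechanism: `m₀(τ) ≤ ∫ Re tr τ(C U (D U)⁻¹) dμ`. -/
theorem le_integral_re_trace_mul_inv_of_rp (hτ : Continuous τ) {μ : Measure (ι → G)}
    [IsProbabilityMeasure μ] {Θ : (ι → G) → (ι → G)} {C D : (ι → G) → G}
    (hC : WilsonRP.EntryMeasurable (CompactGroup.unitarize τ hτ) C)
    (hD : WilsonRP.EntryMeasurable (CompactGroup.unitarize τ hτ) D) (hΘ : ∀ U, C (Θ U) = D U)
    (hRP : ∀ a b, 0 ≤ ∫ U, (starRingEnd ℂ)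
      (((1 - TwistedSlab.haarAvg τ hτ) * CompactGroup.unitarize τ hτ (C (Θ U))) a b) *
      ((1 - TwistedSlab.haarAvg τ hτ) * CompactGroup.unitarize τ hτ (C U)) a b ∂μ) :
    ∫ k, ((τ k).trace).re ∂(haarProbability G) ≤ ∫ U, ((τ (C U * (D U)⁻¹)).trace).re ∂μ := by
  have h := integral_re_trace_mul_inv_sub_nonneg_of_rp τ hτ hC hD hΘ hRP
  rw [integral_sub (integrable_re_trace_mul_inv τ hτ hC hD) (integrable_const _), integral_const,
    probReal_univ, one_smul, re_trace_haarAvg] at h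
  linarith

end Mechanism

/-! ## Torus: every character of the cut plaquette -/

section Torus

variable {d L N M : ℕ} [NeZero L] {G : Type*} [Group G] [TopologicalSpace G] [IsTopologicalGroup G]
  [CompactSpace G] [MeasurableSpace G] [BorelSpace G] (ρ : G →* Matrix (Fin N) (Fin N) ℂ)
  (τ : G →* Matrix (Fin M) (Fin M) ℂ)

/-- ★★ **Torus closed-half diagonal RP ⇒ `m₀(τ) ≤ ⟨Re tr τ(U_{0;ij})⟩_{Λ,β}` for EVERY continuous
representation `τ`** (`ρ` the representation of the Wilson action, `L ≥ 2`, `i ≠ j`): the mean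
character of the mirror-cut plaquette is at least the multiplicity `m₀(τ) = ∫ Re tr τ dk` of the
trivial representation in `τ` (`CutLoopCharacterPositivity`: `≥ 0`). -/
theorem wilsonExpectation_re_trace_rep_plaquette_ge_of_diagonalReflectionPositive
    [Fact (1 < L)] (hρ : Continuous ρ) (hτ : Continuous τ) {β : ℝ} {i j : Fin d} (hij : i ≠ j)
    (hRP : DiagonalReflectionPositive (d := d) (L := L) ρ β i j) :
    ∫ k, ((τ k).trace).re ∂(haarProbability G) ≤ wilsonExpectation ρ β
      (fun U : GaugeConfig d L G => (τ (plaquetteHolonomy U 0 i j)).trace.re) := by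
  haveI := isProbabilityMeasure_wilsonMeasure (d := d) (L := L) (G := G) ρ hρ β
  have hσc : Continuous (CompactGroup.unitarize τ hτ) := CompactGroup.continuous_unitarize τ hτ
  unfold wilsonExpectation
  simp_rw [plaquetteHolonomy_zero_eq_mul_inv]
  refine le_integral_re_trace_mul_inv_of_rp τ hτ (Θ := configDiagSwap i j)
    (C := fun U : GaugeConfig d L G => U (0, i) * U ((0 : Site d L).shift i, j))
    (D := fun U : GaugeConfig d L G => U (0, j) * U ((0 : Site d L).shift j, i))
    ((WilsonRP.entryMeasurable_apply hσc _).mul (WilsonRP.entryMeasurable_apply hσc _))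
    ((WilsonRP.entryMeasurable_apply hσc _).mul (WilsonRP.entryMeasurable_apply hσc _))
    (fun U => halfPlaquette_configDiagSwap i j U) fun a b => ?_
  set Q : Matrix (Fin M) (Fin M) ℂ := 1 - TwistedSlab.haarAvg τ hτ with hQ
  exact hRP (fun U => (Q * CompactGroup.unitarize τ hτ (U (0, i) * U ((0 : Site d L).shift i, j))) a b)
    (measurable_proj_unitarize_entry τ hτ Q
      ((WilsonRP.entryMeasurable_apply hσc _).mul (WilsonRP.entryMeasurable_apply hσc _)) a b)
    ⟨∑ c, ‖Q a c‖, fun U => norm_proj_unitarize_entry_le τ hτ Q _ a b⟩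
    (isDiagonalHalfObservable_comp_halfPlaquette hij
      fun x => (Q * CompactGroup.unitarize τ hτ x) a b)

end Torus

/-! ## `ℤ^d`: diagonal-RP states and Class-B states -/

section Zd

variable {d N M : ℕ} {G : Type*} [Group G] [TopologicalSpace G] [IsTopologicalGroup G]
  [CompactSpace G] [MeasurableSpace G] [BorelSpace G] (ρ : G →* Matrix (Fin N) (Fin N) ℂ)
  (τ : G →* Matrix (Fin M) (Fin M) ℂ)

/-- ★★ **A diagonally reflection-positive finite measure on `ℤ^d` has
`0 ≤ ∫ (Re tr τ(U_{0;ij}) - m₀(τ)) dμ`** for every continuous representation `τ` (`μ` reflection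
positive for the swap `configDiagSwapZd i j` on the closed half `diagHalfEdges i j`, `i ≠ j`). -/
theorem integral_re_trace_plaquette_sub_nonneg_of_isReflectionPositiveFor_diag (hτ : Continuous τ)
    {μ : Measure (LGConfig d G)} [IsFiniteMeasure μ] {i j : Fin d} (hij : i ≠ j)
    (hRP : IsReflectionPositiveFor (configDiagSwapZd i j) (diagHalfEdges i j) μ) :
    0 ≤ ∫ U, (((τ (plaquetteHolonomyZd U 0 i j)).trace).re -
      ∫ k, ((τ k).trace).re ∂(haarProbability G)) ∂μ := by
  have hσc : Continuous (CompactGroup.unitarize τ hτ) := CompactGroup.continuous_unitarize τ hτ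
  simp_rw [plaquetteHolonomyZd_zero_eq_mul_inv, ← re_trace_haarAvg τ hτ]
  refine integral_re_trace_mul_inv_sub_nonneg_of_rp τ hτ (Θ := configDiagSwapZd i j)
    (C := fun U : LGConfig d G => U (0, i) * U (Pi.single i 1, j))
    (D := fun U : LGConfig d G => U (0, j) * U (Pi.single j 1, i))
    ((WilsonRP.entryMeasurable_apply hσc _).mul (WilsonRP.entryMeasurable_apply hσc _))
    ((WilsonRP.entryMeasurable_apply hσc _).mul (WilsonRP.entryMeasurable_apply hσc _))
    (fun U => halfPlaquetteZd_configDiagSwapZd i j U) fun a b => ?_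
  set Q : Matrix (Fin M) (Fin M) ℂ := 1 - TwistedSlab.haarAvg τ hτ with hQ
  exact hRP (fun U => (Q * CompactGroup.unitarize τ hτ (U (0, i) * U (Pi.single i 1, j))) a b)
    (measurable_proj_unitarize_entry τ hτ Q
      ((WilsonRP.entryMeasurable_apply hσc _).mul (WilsonRP.entryMeasurable_apply hσc _)) a b)
    ⟨∑ c, ‖Q a c‖, fun U => norm_proj_unitarize_entry_le τ hτ Q _ a b⟩
    (dependsOn_comp_halfPlaquetteZd hij fun x => (Q * CompactGroup.unitarize τ hτ x) a b)

/-- ★★ The probability-measure form on `ℤ^d`: `m₀(τ) ≤ ∫ Re tr τ(U_{0;ij}) dμ` for every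
diagonally RP probability measure and every continuous representation `τ`. -/
theorem integral_re_trace_plaquette_ge_of_isReflectionPositiveFor_diag (hτ : Continuous τ)
    {μ : Measure (LGConfig d G)} [IsProbabilityMeasure μ] {i j : Fin d} (hij : i ≠ j)
    (hRP : IsReflectionPositiveFor (configDiagSwapZd i j) (diagHalfEdges i j) μ) :
    ∫ k, ((τ k).trace).re ∂(haarProbability G) ≤
      ∫ U, ((τ (plaquetteHolonomyZd U 0 i j)).trace).re ∂μ := by
  have h := integral_re_trace_plaquette_sub_nonneg_of_isReflectionPositiveFor_diag τ hτ hij hRP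
  have hσc : Continuous (CompactGroup.unitarize τ hτ) := CompactGroup.continuous_unitarize τ hτ
  have hint : Integrable (fun U : LGConfig d G => ((τ (plaquetteHolonomyZd U 0 i j)).trace).re) μ := by
    simp_rw [plaquetteHolonomyZd_zero_eq_mul_inv]
    exact integrable_re_trace_mul_inv τ hτ
      (C := fun U : LGConfig d G => U (0, i) * U (Pi.single i 1, j))
      (D := fun U : LGConfig d G => U (0, j) * U (Pi.single j 1, i))
      ((WilsonRP.entryMeasurable_apply hσc _).mul (WilsonRP.entryMeasurable_apply hσc _))
      ((WilsonRP.entryMeasurable_apply hσc _).mul (WilsonRP.entryMeasurable_apply hσc _))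
  rw [integral_sub hint (integrable_const _), integral_const, probReal_univ, one_smul] at h
  linarith

/-- ★★ **Every Class-B state has mean plaquette character at least the number of invariants, in
every representation, for every plaquette.** `ω : ClassBState d ρ β` (any `β`; only translation
invariance and the diagonal RP of `ω` are used), `τ` continuous, `x ∈ ℤ^d`, `i ≠ j`:
`m₀(τ) = ∫ Re tr τ dk ≤ ∫ Re tr τ(U_{x;ij}) dω.μ`. -/
theorem ClassBState.integral_re_trace_plaquette_ge {β : ℝ} (ω : ClassBState d ρ β)
    (hτ : Continuous τ) (x : Fin d → ℤ) {i j : Fin d} (hij : i ≠ j) :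
    ∫ k, ((τ k).trace).re ∂(haarProbability G) ≤
      ∫ U, ((τ (plaquetteHolonomyZd U x i j)).trace).re ∂ω.μ := by
  haveI := ω.isProbabilityMeasure
  have h0 := integral_re_trace_plaquette_ge_of_isReflectionPositiveFor_diag τ hτ hij (ω.diagRP i j hij)
  -- move the plaquette to the origin by translation invariance
  have hT : ∫ U, ((τ (plaquetteHolonomyZd U x i j)).trace).re ∂ω.μ =
      ∫ U, ((τ (plaquetteHolonomyZd U 0 i j)).trace).re ∂ω.μ := by
    conv_lhs => rw [← ω.translationInvariant x]
    rw [integral_map_equiv]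
    refine integral_congr_ae (ae_of_all _ fun U => ?_)
    have h := plaquetteHolonomyZd_configShift_add x U 0 i j
    rw [zero_add] at h
    simp only [h]
  rw [hT]
  exact h0

/-- ★★ In particular, in the representation of the action: `m₀(ρ) ≤ ∫ plaquetteObs ρ x i j dω.μ`
for every Class-B state (`i ≠ j`; any `β`). -/
theorem ClassBState.integral_plaquetteObs_ge {β : ℝ} (ω : ClassBState d ρ β)
    (hρ : Continuous ρ) (x : Fin d → ℤ) {i j : Fin d} (hij : i ≠ j) :
    ∫ k, ((ρ k).trace).re ∂(haarProbability G) ≤ ∫ U, plaquetteObs ρ x i j U ∂ω.μ :=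
  ClassBState.integral_re_trace_plaquette_ge ρ ρ ω hρ x hij

end Zd

end

end Summit.QuantumFields.GaugeBoot
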